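import Summits.KontsevichZagierPeriods.KontsevichZagierPeriods.Theorems.LinRedNormalFormArrangementNormalFormStubRebaseSimpleZeroNestedDiffFrameTools

/-!
# Stub `stub_rebaseSimpleZeroTwo`, part `rebaseSimpleZero_nestedDifferent` (crux
`ArrangementNormalForm`, line `janus-bands`) — brick `NestedDiffFrameA`

**The frame piece of the edge expansion is good** (`RebaseDiff.good_frameA`, registered as
`rebaseSimpleZero_frameCoV`). Normalised setting: a clean nested pair `A(y) < tᵢ < tⱼ < β`
over the base cell `cell M` with the literal integrand `K/((y − r)(tᵢ − cᵢ(y))(tⱼ − κ))`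
(`r = ℓ₂` the simple base pole, `cᵢ(y) = λ y + γᵢ` with `λ ≠ 0`, the letter of `tⱼ` and the
upper bound `β` of `tⱼ` CONSTANT). The frame piece of the edge expansion of `tᵢ` to the slope
`0` about `r` carries `f₂ = f · λ (y − r)/(tᵢ − ρ)`, `ρ = cᵢ(r)`, i.e.
`K λ/((tᵢ − cᵢ(y))(tᵢ − ρ)(tⱼ − κ))` — no base pole. In the base chart
`b = tᵢ − cᵢ(y)`, fibres unchanged (`RebaseDiff.coefA`, Jacobian `1/|λ|`), it becomes the
LITERAL integrand `± K/(b (tᵢ − ρ)(tⱼ − κ))` (base pole `b = 0`, constant letters `ρ, κ`) on the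
polytope `Q` cut out by the player comparisons `tᵢ < tⱼ < β`, `A(y(b, tᵢ)) < tᵢ`, the rows of
the old cell read in the chart, and a redundant box row (`RebaseDiff.frameC`); hence it is good
for `GG 0 2 2` by the total-order refinement `RebaseDiff.good_constraints`.

References: M. Kontsevich, D. Zagier, *Periods* (2001), §1.2, rules (1a), (2).
-/

noncomputable section

open Set MeasureTheory MvPolynomial
open Literature.NumberTheory.Transcendental Literature.ModelTheory.ExponentialFields

namespace Summit.KontsevichZagierPeriods.ArrangementNormalForm.JanusBands

namespace RebaseDiff

open SeparatePos RebasePos RebaseZero RebaseNest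

variable {m' : ℕ} {i j : Fin 2} (hij : i ≠ j) (M : Fin m' → Cf) (A : Cf) (β lam ρ r R₀ : ℚ)

/-! ### The image polytope as an order-constrained set -/

/-- The player comparisons cutting out the image polytope of the frame piece in the base chart:
`tᵢ < tⱼ`, `tⱼ < β`, the box row `−R₀ < tᵢ`, the bound `A(y) < tᵢ` and the rows of the old
cell read in the chart `y = r + ((tᵢ − ρ) − b)/λ`. -/
def frameC (i j : Fin 2) (M : Fin m' → Cf) (A : Cf) (β lam ρ r R₀ : ℚ) : Finset ((Fin 2 ⊕ Cf) × (Fin 2 ⊕ Cf)) :=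
  insert (Sum.inl i, Sum.inl j) (insert (Sum.inl j, Sum.inr (mk 0 β))
    (insert (Sum.inr (mk 0 (-R₀)), Sum.inl i)
      (insert (cmpLin i (1 - A.1 (Fin.last 0) / lam) (A.1 (Fin.last 0) / lam)
          (-(A.1 (Fin.last 0) * r - A.1 (Fin.last 0) / lam * ρ + A.2)))
        (Finset.univ.image fun k => cmpLin i ((M k).1 (Fin.last 0) / lam) (-((M k).1 (Fin.last 0) / lam))
          ((M k).1 (Fin.last 0) * r - (M k).1 (Fin.last 0) / lam * ρ + (M k).2)))))

/-- The image polytope. -/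
def frameQ (i j : Fin 2) (M : Fin m' → Cf) (A : Cf) (β lam ρ r R₀ : ℚ) : Set (Fin (0 + 1 + 2) → ℝ) :=
  {w | ∀ q ∈ frameC i j M A β lam ρ r R₀, pv q.1 w < pv q.2 w}

/-- **Membership in the image polytope**, read through the chart. -/
theorem mem_frameQ (hlam : lam ≠ 0) (w : Fin (0 + 1 + 2) → ℝ) :
    w ∈ frameQ i j M A β lam ρ r R₀ ↔ tv w i < tv w j ∧ tv w j < β ∧ (-R₀ : ℝ) < tv w i ∧
      ev A (r + ((tv w i - ρ) - yv w) / lam) < tv w i ∧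
      ∀ k, 0 < ev (M k) (r + ((tv w i - ρ) - yv w) / lam) := by
  simp only [frameQ, frameC, mem_setOf_eq, Finset.forall_mem_insert, Finset.forall_mem_image,
    Finset.mem_univ, true_imp_iff, cmpLin_iff, RebaseZero.pv_inl, RebaseZero.pv_inr, ev_mk,
    ev_chartA lam ρ r hlam]
  push_cast
  refine and_congr Iff.rfl (and_congr (by constructor <;> intro h <;> linarith)
    (and_congr (by constructor <;> intro h <;> linarith) (and_congr ?_ (forall_congr' fun k => ?_))))
  · constructor <;> intro h <;> linarith
  · constructor <;> intro h <;> linarith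

/-- Every fibre is compared from both sides in `frameC`. -/
theorem frameC_hlu (hij : i ≠ j) : ∀ v, (∃ q ∈ frameC i j M A β lam ρ r R₀, q.2 = Sum.inl v) ∧
    (∃ q ∈ frameC i j M A β lam ρ r R₀, q.1 = Sum.inl v) := by
  intro v
  rcases fin_two_eq_or hij v with rfl | rfl
  · exact ⟨⟨(Sum.inr (mk 0 (-R₀)), Sum.inl v), by simp [frameC], rfl⟩,
      ⟨(Sum.inl v, Sum.inl j), by simp [frameC], rfl⟩⟩
  · exact ⟨⟨(Sum.inl i, Sum.inl v), by simp [frameC], rfl⟩,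
      ⟨(Sum.inl v, Sum.inr (mk 0 β)), by simp [frameC], rfl⟩⟩

/-! ### The frame piece is good -/

variable {m : ℕ}

/-- **The frame piece of the edge expansion is good** (normalised setting). Let `s₂` live on
the clean nest `A(y) < tᵢ < tⱼ < β` over `cell M` (`β` constant) and carry the integrand
`f · λ (y − r)/(tᵢ − ρ)` of the frame piece (`RebaseDiff.facF` with target slope `0`), where
`f = K/((y − r)(tᵢ − cᵢ(y))(tⱼ − κ))` is the literal integrand with simple base pole `r`, the
letter `cᵢ` of slope `λ ≠ 0`, the letter `κ` of `tⱼ` constant, `ρ = cᵢ(r)`, and where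
`y ≠ r`, `tᵢ ≠ cᵢ(y)`, `tᵢ ≠ ρ` on the domain. Then `s₂` is good for `GG 0 2 2`: the base
chart `b = tᵢ − cᵢ(y)` (rule 2) makes the integrand literal with constant letters over the
order-constrained polytope `frameQ`, and the total-order refinement applies.
[Kontsevich–Zagier 2001, §1.2, rules (1a), (2)] -/
theorem good_frameA (s₂ : KZ.IntegralRep (0 + 1 + 2)) (hij : i ≠ j) (M : Fin m' → Cf) (A : Cf) (β : ℚ)
    (T : BData) (p : MvPolynomial (Fin 0) ℚ) (a : Fin 2 → Option Cf) (ci cj : Cf)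
    (hi : a i = some ci) (hj : a j = some cj) (hcj : cj.1 (Fin.last 0) = 0) (h1 : T.n₁ = 0)
    (hn : T.n₂ = 1) (hlam : ci.1 (Fin.last 0) ≠ 0) (hbd : Bornology.IsBounded s₂.domain)
    (hdom : s₂.domain = gDom 0 2 m' M (nlo i A) (nhi j (mk 0 β)))
    (hint : EqOn s₂.integrand (fun z => glitB T p a z * facF i ci 0 T.ℓ₂.2 z) s₂.domain)
    (hne : ∀ z ∈ s₂.domain, tv z i ≠ ev ci (yv z))
    (hR : ∀ z ∈ s₂.domain, tv z i ≠ ev (rot ci 0 T.ℓ₂.2) (yv z))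
    (hy : ∀ z ∈ s₂.domain, yv z ≠ T.ℓ₂.2) : Good 2 (KZ.of s₂) := by
  -- notation
  set lam : ℚ := ci.1 (Fin.last 0) with hlamdef
  set r : ℚ := T.ℓ₂.2 with hrdef
  set ρ : ℚ := ci.2 - (0 - lam) * r with hρdef
  have hrot : rot ci 0 r = mk 0 ρ := rfl
  have hl : (lam : ℝ) ≠ 0 := by exact_mod_cast hlam
  have hci : ∀ y : ℝ, ev ci y = lam * y + ci.2 := fun y => rfl
  have hcjv : ∀ y : ℝ, ev cj y = cj.2 := fun y => by rw [ev, hcj, Rat.cast_zero, zero_mul, zero_add]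
  -- a box row
  obtain ⟨Rb, hRb⟩ := hbd.exists_norm_le
  obtain ⟨R₀, hR₀⟩ := exists_rat_gt Rb
  have hbox : ∀ z ∈ s₂.domain, (-R₀ : ℝ) < tv z i := fun z hz => by
    have h1 := (norm_le_pi_norm z (tIdx i)).trans (hRb z hz)
    rw [Real.norm_eq_abs] at h1
    have := (abs_le.1 h1).1
    show (-R₀ : ℝ) < z (tIdx i)
    linarith
  -- the chart
  set Ψ := rkMap (coefA i lam) xA (c₀A lam ρ r) with hΨ
  set Q := frameQ i j M A β lam ρ r R₀ with hQ
  have mD := fun z => mem_nDom hij M A (mk 0 β) z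
  have hRD : ∀ w ∈ Q, Ψ w ∈ s₂.domain := fun w hw => by
    rw [hQ, mem_frameQ M A β lam ρ r R₀ hlam] at hw
    obtain ⟨h1, h2, -, h4, h5⟩ := hw
    rw [hdom, mD, yv_psiA hij, tv_psiA, tv_psiA, ev_mk]
    push_cast
    exact ⟨h5, h4, h1, by linarith⟩
  have hDR : ∀ z ∈ s₂.domain, rkInv (coefA i lam) xA (c₀A lam ρ r) z ∈ Q := fun z hz => by
    have hz' := hz
    rw [hdom, mD, ev_mk] at hz'
    obtain ⟨h5, h4, h1, h2⟩ := hz'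
    push_cast at h2
    rw [hQ, mem_frameQ M A β lam ρ r R₀ hlam, chartA_roundtrip hij lam ρ r hlam, tv_invA, tv_invA]
    exact ⟨h1, by linarith, hbox z hz, h4, h5⟩
  -- the new literal datum
  set T' : BData := ⟨T.m, T.L, T.e, T.ℓ₁, 0, 0, 1⟩ with hT'
  set sg : ℚ := if 0 < lam then 1 else -1 with hsg
  set a' : Fin 2 → Option Cf := Function.update a i (some (mk 0 ρ)) with ha'
  have ha'i : a' i = some (mk 0 ρ) := by rw [ha', Function.update_self]
  have ha'j : a' j = some cj := by rw [ha', Function.update_of_ne hij.symm, hj]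
  set f' : (Fin (0 + 1 + 2) → ℝ) → ℝ := glitB T' (MvPolynomial.C sg * p) a' with hf'
  have hsgabs : (sg : ℝ) = lam / |(lam : ℝ)| := by
    rw [hsg]
    split_ifs with h
    · have h' : (0 : ℝ) < lam := by exact_mod_cast h
      rw [abs_of_pos h', div_self hl, Rat.cast_one]
    · have h' : (lam : ℝ) < 0 := lt_of_le_of_ne (by exact_mod_cast not_lt.1 h) hl
      rw [abs_of_neg h', div_neg, div_self hl, Rat.cast_neg, Rat.cast_one]
  have hJ : |((rkJac (coefA i lam) xA : ℚ) : ℝ)| = 1 / |(lam : ℝ)| := by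
    rw [rkJac_A, Rat.cast_neg, abs_neg, Rat.cast_div, Rat.cast_one, abs_div, abs_one]
  have hf : ∀ w ∈ Q, f' w = s₂.integrand (Ψ w) * |((rkJac (coefA i lam) xA : ℚ) : ℝ)| := by
    intro w hw
    have hzD := hRD w hw
    -- values of the chart
    have ey : yv (Ψ w) = r + ((tv w i - ρ) - yv w) / lam := yv_psiA hij lam ρ r w
    have ei : tv (Ψ w) i = tv w i := tv_psiA lam ρ r w i
    have ej : tv (Ψ w) j = tv w j := tv_psiA lam ρ r w j
    set y' : ℝ := (r : ℝ) + ((tv w i - ρ) - yv w) / lam with hy'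
    have hyr : y' - r ≠ 0 := by
      have h := sub_ne_zero.2 (hy _ hzD)
      rwa [ey] at h
    have hρ' : tv w i - ρ ≠ 0 := by
      have h := hR _ hzD
      rw [hrot, ei, ev_mk, Rat.cast_zero, zero_mul, zero_add] at h
      exact sub_ne_zero.2 h
    have eb : tv w i - ((lam : ℝ) * y' + ci.2) = yv w := by
      rw [hy', hρdef]; push_cast; field_simp; ring
    have hb : yv w ≠ 0 := by
      have h := sub_ne_zero.2 (hne _ hzD)
      rwa [ei, ey, hci, eb] at h
    -- the two sides
    have hT'ℓ : T'.ℓ₂ = 0 := rfl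
    have hK : Kc T' p = Kc T p := rfl
    have eL : f' w = sg * (Kc T p * (1 / (yv w - 0)) * ((1 / (tv w i - ρ)) * (1 / (tv w j - cj.2)))) := by
      rw [hf', glit_C_mul, glitB_two T' p a' hij (mk 0 ρ) cj ha'i ha'j rfl rfl, ev_mk, hcjv, hK, hT'ℓ]
      simp only [Prod.snd_zero, Rat.cast_zero, zero_mul, zero_add]
    have eR : s₂.integrand (Ψ w) * |((rkJac (coefA i lam) xA : ℚ) : ℝ)| =
        Kc T p * (1 / (y' - r)) * ((1 / (yv w)) * (1 / (tv w j - cj.2))) *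
          ((lam : ℝ) * (y' - r) / (tv w i - ρ)) * (1 / |(lam : ℝ)|) := by
      rw [hint hzD]
      dsimp only
      rw [hJ, glitB_two T p a hij ci cj hi hj h1 hn, ← hrdef, facF, ← hlamdef, hrot, ei, ej, ev_mk, hcjv,
        hci, ey, eb]
      congr 2
      push_cast
      ring
    rw [eL, eR, hsgabs]
    by_cases hv : tv w j - (cj.2 : ℝ) = 0
    · rw [hv]; simp
    have habs : |(lam : ℝ)| ≠ 0 := abs_ne_zero.2 hl
    rw [sub_zero]
    field_simp
  -- rule (2)
  obtain ⟨r₃, hd₃, hi₃, hbd₃, hrel⟩ := rankOne_cov s₂ (coefA i lam) xA (c₀A lam ρ r) (rkJac_A_ne lam hlam)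
    (isSemialgebraic_cmpSet _) hRD hDR f'
    (isSemialgebraicFunOn_glit (isSemialgebraic_cmpSet _) _ _ _ _ _ _ _ _) hf
  -- the cells
  refine RebaseZero.good_of_sub_mem hrel (good_constraints r₃ (frameC i j M A β lam ρ r R₀) T.L T.e
    (MvPolynomial.C sg * p) T.ℓ₁ 0 a' rfl rfl ⟨0, fun l c hc => ?_⟩ (hbd₃ hbd) (frameC_hlu M A β lam ρ r R₀ hij)
    hd₃ (fun w _ => by rw [hi₃, hf']; rfl))
  rcases fin_two_eq_or hij l with rfl | rfl
  · rw [ha'i] at hc; cases hc; rfl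
  · rw [ha'j] at hc; cases hc; exact hcj

end RebaseDiff

/-- **Registered brick `rebaseSimpleZero_frameCoV` of the part `rebaseSimpleZero_nestedDifferent`
(stub `stub_rebaseSimpleZeroTwo`, line `janus-bands`): the frame piece of the edge expansion is
good.** On a clean nest `A(y) < tᵢ < tⱼ < β` (literal `GS 0 2` bound data `nlo i A`, `nhi j β`
with `β` constant) a representation carrying the integrand `f · λ (y − r)/(tᵢ − ρ)` of the frame
piece — `f` the literal integrand with simple base pole `r = ℓ₂`, the letter `cᵢ` of `tᵢ` of
slope `λ ≠ 0`, the letter of `tⱼ` constant, `ρ = cᵢ(r)`; `y ≠ r`, `tᵢ ≠ cᵢ(y)`, `tᵢ ≠ ρ` on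
the domain — is congruent modulo `KZ.relations` to the subgroup generated by the literal
rebased class `GG 0 2 2`: the base chart `b = tᵢ − cᵢ(y)` (rule 2, Jacobian `1/|λ|`) makes the
integrand literal with constant letters `ρ, κ` and base pole `b = 0` on an order-constrained
polytope, whose cells are good (`RebaseDiff.good_frameA`). [Kontsevich–Zagier 2001, §1.2] -/
theorem rebaseSimpleZero_frameCoV (m' : ℕ) (s₂ : KZ.IntegralRep (0 + 1 + 2)) (i j : Fin 2) (hij : i ≠ j) (M : Fin m' → (Fin (0 + 1) → ℚ) × ℚ) (A : (Fin (0 + 1) → ℚ) × ℚ) (β : ℚ) (T : RebaseZero.BData) (p : MvPolynomial (Fin 0) ℚ) (a : Fin 2 → Option ((Fin (0 + 1) → ℚ) × ℚ)) (ci cj : (Fin (0 + 1) → ℚ) × ℚ) (hi : a i = some ci) (hj : a j = some cj) (hcj : cj.1 (Fin.last 0) = 0) (h1 : T.n₁ = 0) (hn : T.n₂ = 1) (hlam : ci.1 (Fin.last 0) ≠ 0) (hbd : Bornology.IsBounded s₂.domain) (hdom : s₂.domain = SeparatePos.gDom 0 2 m' M (RebaseNest.nlo i A) (RebaseNest.nhi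 j (RebaseZero.mk 0 β))) (hint : EqOn s₂.integrand (fun z => RebaseZero.glitB T p a z * RebaseDiff.facF i ci 0 T.ℓ₂.2 z) s₂.domain) (hne : ∀ z ∈ s₂.domain, RebaseZero.tv z i ≠ RebaseZero.ev ci (RebaseZero.yv z)) (hR : ∀ z ∈ s₂.domain, RebaseZero.tv z i ≠ RebaseZero.ev (RebaseDiff.rot ci 0 T.ℓ₂.2) (RebaseZero.yv z)) (hy : ∀ z ∈ s₂.domain, RebaseZero.yv z ≠ T.ℓ₂.2) : ∃ c ∈ AddSubgroup.closure (SeparatePos.GGset 0 2 2), KZ.of s₂ - c ∈ KZ.relations :=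
  RebaseDiff.good_frameA s₂ hij M A β T p a ci cj hi hj hcj h1 hn hlam hbd hdom hint hne hR hy

end Summit.KontsevichZagierPeriods.ArrangementNormalForm.JanusBands
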